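import Summits.Ventures.YMGap.Conjectures.StrongCouplingChiralLROEveryCoupling
import Literature.MathematicalPhysics.StatisticalMechanics.GradedKernelChiralLRO
import Literature.MathematicalPhysics.QuantumLattice.StaggeredTranslationInvariance
import HarnessLib
import HarnessLib.Audit.Tags

/-!
# Venture YMGap — Conjectures/StrongCouplingChiralLROReduction.lean: the typed Y3 conjecture
# `SalmhoferSeilerSmallBeta` REDUCED to its two missing volume-uniform inputs at small `β`
# (an infrared bound and a Schwinger–Dyson bound), with both inputs DISCHARGED at `β = 0`

HONEST FRAMING (venture `Summits/Ventures/YMGap`, cell `pub-ymgap`, seat qcd-lit g18, `bears_on: Q1`).  The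
conjecture `Summit.Ventures.YMGap.Conjectures.SalmhoferSeilerSmallBeta` (`Conjectures/StrongCouplingChiralLRO.lean`)
is NOT proved here and remains open (`β > 0` uniformly in `L`: not in print).  This file makes the
cell's prose census of "what an extension of Salmhofer–Seiler to small `β > 0` needs" (memo
`run/shared/lean/pub/pub-ymgap/qcd-lit/Y3-INPUTS-INPRINT.md`, rows S3 and S4) KERNEL-EXACT:

* **(IR)_{β,A}** (row S3; written out as an explicit hypothesis, no definition is introduced) — the
  mode-wise infrared bound of Salmhofer–Seiler (3.112)–(3.113) for the conjecture's massless two-point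
  kernel `T_β(x) = ssTwoPoint N ν L β 0 0 x` at coupling `β`: `2D(k) T̂_β(k) ≤ A` and `-2D(k+π̂) T̂_β(k) ≤ A`
  for all momenta `k ∉ {0, π̂}`, i.e. all characters `χ = e^{ik·}` with `-ν < C(k) < ν`
  (`C(k) = ∑_μ cos k_μ = ComplexSpin.cosSum χ`, `D = ν - C`, `T̂_β(k) = Re ∑_x T_β(x) χ(x) = Re kernelSymbol`);
* **(SD)_{β,b}** (row S4) — the nearest-neighbour lower bound (4.38)/(4.40): `∑_μ (T_β(e_μ) + T_β(-e_μ)) ≥ b`;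
* **`ssChiralOrder_ge_of_bounds`** — at ANY real `β`, on any even torus (`ν ≥ 1`):
  `(IR)_{β,A} ∧ (SD)_{β,b} ⇒ ssChiralOrder N ν L β ≥ (1/4ν)(b - 2A·S_Λ(ν))`
  (the printed step (4.12)–(4.14)/(4.40)–(4.42), model-independently: the tree's
  `ComplexSpin.kernel_chiralLRO_of_bounds'`, fed with the translation invariance
  (`ssTwoPoint_massless_add`, staggered shift symmetry, `StaggeredTranslationInvariance`), the symmetry
  and the chiral grading (`ssTwoPoint_massless_eq_zero_of_sgn_eq`) of the typed two-point function,
  all of which hold at EVERY `β`);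
* **`salmhoferSeilerSmallBeta_of_uniform_bounds`** — THE REDUCTION: if for each `1 ≤ N ≤ 4`, `ν ≥ 4`
  there are `β₀ > 0`, `A ≥ 0`, `b` with `2A·S(ν) < b` and `L₀` such that `(IR)_{β,A}` and `(SD)_{β,b}` hold
  on `(ℤ/Lℤ)^ν` for all `0 ≤ β < β₀` and all even `L ≥ L₀`, then
  `SalmhoferSeilerSmallBeta` holds (`S(ν)` the printed constant (4.3), tree `ComplexSpin.fluctS`;
  `S_Λ(ν) → S(ν)` is the tree's `latticeS_tendsto_fluctS`);
* **non-vacuity at `β = 0`** — `infraredBound_zero` (`A = 4N`, i.e. Thm. 3.21's `N⁻¹` in the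
  normalisation `ψ̄ψ = 2N·σ` of the conjecture) and `schwingerDysonBound_zero` (`b = (2N)²/K(N)`,
  (4.38) with Remark 4.6's `K(N)`), for `1 ≤ N ≤ 4`, from the tree's `β = 0` theorems
  (`ComplexSpin.twoPtHat_mode_le`, `ComplexSpin.partitionFunction_le_sd`) through the bosonisation
  dictionary `ssTwoPoint_zero_eq_expect` (`⟨ψ̄ψ(x)ψ̄ψ(y)⟩_{Λ,0,0} = (2N)²⟨σ_xσ_y⟩_Λ`, Salmhofer–Seiler
  (2.21)/(2.24)); whence `ssChiralOrder_zero_ge` — the reduction reproduces (4.42) at `β = 0`: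
  `ssChiralOrder N ν L 0 ≥ (2N)²(1/4ν)(1/K(N) - 2S_Λ(ν)/N)`.

So the open content of Y3 is EXACTLY: extend `infraredBound_zero` and `schwingerDysonBound_zero` from
`β = 0` to `0 ≤ β < β₀` with constants independent of `L` (any `A`, `b` with `2A·S(ν) < b`).  Neither
extension is in print (memo rows S3/S4); nothing here claims them.

WHAT THIS IS NOT: no bound at any `β > 0`; nothing about `SU(N)`, Wilson fermions, the continuum,
`IsChiralAtZero`, a mass gap, or the Clay problem.  Theorems only (the two hypotheses are spelled out as
binders, not introduced as definitions); no facts, no `sorry`.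

References: M. Salmhofer, E. Seiler, Commun. Math. Phys. 139 (1991) 395–432: (2.21), (2.24), (3.100)–(3.113),
Thm. 3.21, Def. 4.1 (4.3), (4.12)–(4.14), Thm. 4.8 (4.38)–(4.42), Cor. 4.9 [SalmhoferSeiler1991].
-/

noncomputable section

namespace Summit.Ventures.YMGap.Conjectures

open MeasureTheory Finset
open Literature.MathematicalPhysics.QuantumLattice Literature.MathematicalPhysics.QuantumFieldTheory
open Literature.MathematicalPhysics.StatisticalMechanics
open Literature.Probability.LatticeModels (TorusSite)

/-! ### Structure of the typed two-point function at every `β` -/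

/-- **Translation invariance at every coupling**: `ssTwoPoint N ν L β 0 (x + c) (y + c) = ssTwoPoint N ν L β 0 x y`
(staggered shift symmetry on the even torus). [cite: SalmhoferSeiler1991, (3.100) with §2 (2.3)–(2.4)] -/
theorem ssTwoPoint_massless_add (N ν L : ℕ) [NeZero L] (hL : Even L) (β : ℝ) (x y c : TorusSite ν L) :
    ssTwoPoint N ν L β 0 (x + c) (y + c) = ssTwoPoint N ν L β 0 x y := by
  exact StaggeredShift.detRep_twoPoint_add (N := N) hL β x y c

/-- **Symmetry at every coupling**: `ssTwoPoint N ν L β 0 x y = ssTwoPoint N ν L β 0 y x`. [cite: SalmhoferSeiler1991, (3.100) with §2 (2.10)–(2.11)] -/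
theorem ssTwoPoint_massless_comm (N ν L : ℕ) [NeZero L] (β : ℝ) (x y : TorusSite ν L) :
    ssTwoPoint N ν L β 0 x y = ssTwoPoint N ν L β 0 y x := by
  exact StaggeredShift.detRep_twoPoint_comm (N := N) β x y

/-! ### (IR)_β + (SD)_β ⇒ long-range order at β, in every volume -/

/-- **Rows S3 + S4 ⇒ the conjecture's inequality, at any coupling and volume**: on the even torus
`(ℤ/Lℤ)^ν` (`ν ≥ 1`), the mode-wise infrared bound (IR)_{β,A} (`2(ν - C(χ))T̂_β(χ) ≤ A`,
`-2(ν + C(χ))T̂_β(χ) ≤ A` for all characters with `-ν < C(χ) < ν`, i.e. `χ ∉ {0, π̂}`) and the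
Schwinger–Dyson bound (SD)_{β,b} (`∑_μ (T_β(e_μ) + T_β(-e_μ)) ≥ b`) give
`ssChiralOrder N ν L β ≥ (1/4ν)(b - 2A·S_Λ(ν))` — the printed step (4.12)–(4.14)/(4.40)–(4.42), using
only translation invariance, symmetry and the `m = 0` chiral grading of the two-point function, all
valid at every `β`. [cite: SalmhoferSeiler1991, Thm. 4.8 ((4.40)–(4.42)) with (3.106)] -/
theorem ssChiralOrder_ge_of_bounds (N ν L : ℕ) [NeZero L] (hν : 1 ≤ ν) (hL : Even L) {β A b : ℝ}
    (hIR : ∀ χ : AddChar (TorusSite ν L) ℂ, -(ν : ℝ) < ComplexSpin.cosSum χ → ComplexSpin.cosSum χ < ν →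
      2 * ((ν : ℝ) - ComplexSpin.cosSum χ) *
          (ComplexSpin.kernelSymbol (fun x y => ssTwoPoint N ν L β 0 x y) χ).re ≤ A ∧
        2 * ((ν : ℝ) + ComplexSpin.cosSum χ) *
          (-(ComplexSpin.kernelSymbol (fun x y => ssTwoPoint N ν L β 0 x y) χ).re) ≤ A)
    (hSD : b ≤ ∑ μ : Fin ν, (ssTwoPoint N ν L β 0 0 (Pi.single μ 1) + ssTwoPoint N ν L β 0 0 (-Pi.single μ 1))) :
    1 / (4 * ν) * (b - 2 * A * ComplexSpin.latticeS ν L) ≤ ssChiralOrder N ν L β := by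
  have h := ComplexSpin.kernel_chiralLRO_of_bounds' (G := fun x y => ssTwoPoint N ν L β 0 x y) hν hL
    (fun x y a => ssTwoPoint_massless_add N ν L hL β x y a) (fun x y => ssTwoPoint_massless_comm N ν L β x y)
    (fun z hz => by
      refine ssTwoPoint_massless_eq_zero_of_sgn_eq N ν L hν hL.two_dvd β ?_
      rw [ComplexSpin.sgn_zero]
      unfold ComplexSpin.sgn
      rw [if_pos hz])
    (A := A) (b := b)
    (fun χ h0 hε => hIR χ (ComplexSpin.neg_lt_cosSum_of_ne_stagChar hL.two_dvd hε)
      (ComplexSpin.cosSum_lt_of_ne_zero h0))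
    hSD
  unfold ssChiralOrder
  exact h

/-! ### The reduction -/

/-- **REDUCTION OF Y3.**  If for every `1 ≤ N ≤ 4`, `ν ≥ 4` there are `β₀ > 0`, `A ≥ 0` and `b` with
`2A·S(ν) < b`, and `L₀`, such that the infrared bound (IR)_{β,A} (row S3: `2(ν ∓ C(χ))(±T̂_β(χ)) ≤ A` off
`χ ∈ {0, π̂}`) and the Schwinger–Dyson bound (SD)_{β,b} (row S4: `∑_μ (T_β(e_μ) + T_β(-e_μ)) ≥ b`) hold for
the conjecture's kernel `T_β = ssTwoPoint N ν L β 0` for all `0 ≤ β < β₀` and all even `L ≥ L₀`, then the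
typed conjecture `SalmhoferSeilerSmallBeta` holds.  (At `β = 0` both hypotheses are
theorems with `A = 4N`, `b = (2N)²/K(N)`, `2A·S(ν) < b` being the printed condition `2S(ν)K(N)/N < 1`;
their volume-uniform extension to small `β > 0` is the open content — not in print.) [cite: SalmhoferSeiler1991, Thm. 4.8 and Cor. 4.9 with (4.41)–(4.42)] -/
theorem salmhoferSeilerSmallBeta_of_uniform_bounds
    (h : ∀ N ν : ℕ, 1 ≤ N → N ≤ 4 → 4 ≤ ν →
      ∃ β₀ : ℝ, 0 < β₀ ∧ ∃ A : ℝ, 0 ≤ A ∧ ∃ b : ℝ, 2 * A * ComplexSpin.fluctS ν < b ∧ ∃ L₀ : ℕ,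
        ∀ β : ℝ, 0 ≤ β → β < β₀ → ∀ (L : ℕ) [NeZero L], Even L → L₀ ≤ L →
          (∀ χ : AddChar (TorusSite ν L) ℂ, -(ν : ℝ) < ComplexSpin.cosSum χ → ComplexSpin.cosSum χ < ν →
            2 * ((ν : ℝ) - ComplexSpin.cosSum χ) *
                (ComplexSpin.kernelSymbol (fun x y => ssTwoPoint N ν L β 0 x y) χ).re ≤ A ∧
              2 * ((ν : ℝ) + ComplexSpin.cosSum χ) *
                (-(ComplexSpin.kernelSymbol (fun x y => ssTwoPoint N ν L β 0 x y) χ).re) ≤ A) ∧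
          b ≤ ∑ μ : Fin ν, (ssTwoPoint N ν L β 0 0 (Pi.single μ 1) + ssTwoPoint N ν L β 0 0 (-Pi.single μ 1))) :
    SalmhoferSeilerSmallBeta := by
  intro N ν hN1 hN4 hν
  obtain ⟨β₀, hβ₀, A, hA, b, hAb, L₀, hL₀⟩ := h N ν hN1 hN4 hν
  have hν3 : 3 ≤ ν := by omega
  have hν1 : 1 ≤ ν := by omega
  obtain ⟨c, hc, L₁, hL₁⟩ := ComplexSpin.kernel_chiralLRO_uniform (ν := ν) hν3 hA hAb
  refine ⟨β₀, hβ₀, c, hc, max L₀ L₁, fun β hβ hββ₀ L _ hE hLe => ?_⟩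
  obtain ⟨hIR, hSD⟩ := hL₀ β hβ hββ₀ L hE ((le_max_left L₀ L₁).trans hLe)
  have h := hL₁ L hE ((le_max_right L₀ L₁).trans hLe) (fun x y => ssTwoPoint N ν L β 0 x y)
    (fun x y a => ssTwoPoint_massless_add N ν L hE β x y a) (fun x y => ssTwoPoint_massless_comm N ν L β x y)
    (fun z hz => by
      refine ssTwoPoint_massless_eq_zero_of_sgn_eq N ν L hν1 hE.two_dvd β ?_
      rw [ComplexSpin.sgn_zero]
      unfold ComplexSpin.sgn
      rw [if_pos hz])
    (fun χ h0 hε => hIR χ (ComplexSpin.neg_lt_cosSum_of_ne_stagChar hE.two_dvd hε)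
      (ComplexSpin.cosSum_lt_of_ne_zero h0))
    hSD
  unfold ssChiralOrder
  exact h

/-! ### Non-vacuity: both inputs hold at `β = 0` (the printed theorems, transported) -/

section Zero

open StrongCoupling StaggeredSingular

variable {N ν L : ℕ} [NeZero L]

/-- **The bosonisation dictionary for the two-point function at `β = 0`**:
`ssTwoPoint N ν L 0 0 x y = (2N)² ⟨σ_xσ_y⟩_Λ`, `⟨·⟩_Λ` the `U(N)` complex-spin expectation of
Salmhofer–Seiler §2 (`ψ̄ψ(x) = 2N σ_x`, (2.21)/(2.24); determinant representation = Berezin form a.e.). [cite: SalmhoferSeiler1991, §2 (2.21) and (2.24)] -/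
theorem ssTwoPoint_zero_eq_expect [NeZero ν] (hN : 1 ≤ N) (hL : Even L) (x y : TorusSite ν L) :
    ssTwoPoint N ν L 0 0 x y =
      (2 * N) ^ 2 * ComplexSpin.expect N 0 (ComplexSpin.uNBondCoeff N) (MvPolynomial.X x * MvPolynomial.X y) := by
  classical
  letI : LinearOrder (TorusSite ν L) :=
    LinearOrder.lift' (Fintype.equivFin (TorusSite ν L)) (Fintype.equivFin (TorusSite ν L)).injective
  have hL1 : 1 < L := StaggeredRP.one_lt_of_even_neZero hL
  have h2N : (2 * N : ℂ) ≠ 0 := by exact_mod_cast (by omega : 2 * N ≠ 0)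
  have hΓ : ∀ b : TorusSite ν L × Fin ν, stagSigns ν L b ^ 2 = 1 := fun b => staggeredPhase_sq b.1 b.2
  -- `⟨spinObs(σ_xσ_y)⟩ = ⟨σ_xσ_y⟩_spin` and `spinObs(σ_xσ_y) = (2N)⁻² ψ̄ψ(x)ψ̄ψ(y)`
  have hspin := fermiExpect_spinObs (N := N) hL1 (stagSigns ν L) hΓ 0 (MvPolynomial.X x * MvPolynomial.X y)
  rw [spinObs_X_mul_X, smul_meson_mul_smul_meson, fermiExpect, fermiBracket_const_smul _ (torusLinks_ne hL1),
    mul_div_assoc] at hspin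
  have hN0 : (N : ℂ) ≠ 0 := by exact_mod_cast (by omega : N ≠ 0)
  have hmm : fermiExpect (torusLinks ν L) (stagSigns ν L) ((0 : ℝ) : ℂ)
      (fun _ => (meson x * meson y : FermiAlg (TorusSite ν L) N)) =
      (2 * N : ℂ) ^ 2 * (ComplexSpin.expect N 0 (ComplexSpin.uNBondCoeff N)
        (MvPolynomial.X x * MvPolynomial.X y) : ℂ) := by
    rw [fermiExpect, ← hspin]
    field_simp
  have hdet := StrongCoupling.detRep_twoPoint_eq_fermiExpect_re (N := N) hL hL1 x y
  unfold ssTwoPoint ssPartitionFunction ssFermionDet ssWick ssDirac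
  rw [show (fun U : GaugeConfig ν L (UN N) => ((staggeredDirac (unitaryFundamentalRep (Fin N) ℂ) U 0).det).re *
      (let G := (staggeredDirac (unitaryFundamentalRep (Fin N) ℂ) U 0)⁻¹
       ((∑ a : Fin N, G (x, a) (x, a)) * (∑ b : Fin N, G (y, b) (y, b)) -
          ∑ a : Fin N, ∑ b : Fin N, G (x, a) (y, b) * G (y, b) (x, a)).re)) =
      fun U => ((D0 U).det).re * (wick2 (D0 U)⁻¹ x y).re from rfl, hdet, hmm]
  rw [show ((2 : ℂ) * N) ^ 2 * (ComplexSpin.expect N 0 (ComplexSpin.uNBondCoeff N)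
      (MvPolynomial.X x * MvPolynomial.X y) : ℂ) =
      (((2 * N : ℝ) ^ 2 * ComplexSpin.expect N 0 (ComplexSpin.uNBondCoeff N)
        (MvPolynomial.X x * MvPolynomial.X y) : ℝ) : ℂ) by push_cast; ring, Complex.ofReal_re]

/-- The symbol is linear in the kernel (scalar multiples). [cite: SalmhoferSeiler1991, (3.105)] -/
theorem kernelSymbol_const_mul (c : ℝ) (G : TorusSite ν L → TorusSite ν L → ℝ) (χ : AddChar (TorusSite ν L) ℂ) :
    ComplexSpin.kernelSymbol (fun x y => c * G x y) χ = (c : ℂ) * ComplexSpin.kernelSymbol G χ := by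
  unfold ComplexSpin.kernelSymbol
  rw [Finset.mul_sum]
  exact Finset.sum_congr rfl fun z _ => by push_cast; ring

/-- **Row S3 at `β = 0` is a theorem**: (IR)_{0,4N} for `1 ≤ N ≤ 4` on every even torus (`ν ≥ 1`), at
EVERY character (in particular off `{0, π̂}`) — Salmhofer–Seiler's infrared bound Thm. 3.21 in the form
(3.112)–(3.113), `2D T̂ ≤ N⁻¹`, times the normalisation `(2N)²` of `ψ̄ψ = 2Nσ`. [cite: SalmhoferSeiler1991, Thm. 3.21 with (3.112)–(3.113)] -/
theorem infraredBound_zero (hN1 : 1 ≤ N) (hN4 : N ≤ 4) (hν : 1 ≤ ν) (hL : Even L)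
    (χ : AddChar (TorusSite ν L) ℂ) :
    2 * ((ν : ℝ) - ComplexSpin.cosSum χ) *
          (ComplexSpin.kernelSymbol (fun x y => ssTwoPoint N ν L 0 0 x y) χ).re ≤ 4 * N ∧
      2 * ((ν : ℝ) + ComplexSpin.cosSum χ) *
          (-(ComplexSpin.kernelSymbol (fun x y => ssTwoPoint N ν L 0 0 x y) χ).re) ≤ 4 * N := by
  haveI : NeZero ν := ⟨by omega⟩
  set a := ComplexSpin.uNBondCoeff N with ha
  set w := ComplexSpin.uNLogCoeff N with hw
  have hlog : ComplexSpin.HasLog N a w := ComplexSpin.hasLog_uN hN1 hN4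
  have ha0 : a 0 = 1 := ComplexSpin.uNBondCoeff_zero N
  have hw1 : w 1 = 1 := ComplexSpin.uNLogCoeff_one N
  have hwk : ∀ k, 2 ≤ k → k ≤ N → 0 ≤ w k := fun k hk2 hkN => ComplexSpin.uNLogCoeff_nonneg hN4 k hk2 hkN
  have hw' : ∀ k, 1 ≤ k → k ≤ N → 0 ≤ w k := by
    intro k hk1 hkN
    rcases Nat.lt_or_ge k 2 with hk | hk
    · rw [show k = 1 by omega, hw1]; exact zero_le_one
    · exact hwk k hk hkN
  have hb : ∀ k ≤ N, 0 ≤ ComplexSpin.fluctCoeff N a k := ComplexSpin.fluctCoeff_nonneg_of_hasLog hlog ha0 hw1 hwk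
  have hL2 : 2 ≤ L := by obtain ⟨k, hk⟩ := hL; have := NeZero.ne L; omega
  have hapos := hlog.coeff_pos hN1 ha0 hw1 hwk
  have hZ : 0 < ComplexSpin.partitionFunction (ν := ν) (L := L) N 0 a :=
    ComplexSpin.partitionFunction_pos hL.two_dvd hL2 hν le_rfl (hlog.coeff_nonneg ha0 hw') (hapos 0 (Nat.zero_le N))
      (hapos N le_rfl)
  have hcard : 2 ≤ Fintype.card (TorusSite ν L) := by
    rw [Fintype.card_fun, ZMod.card, Fintype.card_fin]
    calc 2 ≤ L := hL2
      _ ≤ L ^ ν := Nat.le_self_pow (by omega) L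
  set i : Fin ν := ⟨0, hν⟩
  -- the conjecture's kernel at `β = 0` is `(2N)²/Z` times the unnormalised complex-spin kernel `twoPt`
  set Z := ComplexSpin.partitionFunction (ν := ν) (L := L) N 0 a with hZdef
  have hker : (fun x y => ssTwoPoint N ν L 0 0 x y) =
      fun x y => ((2 * N : ℝ) ^ 2 / Z) * ComplexSpin.twoPt N 0 a x y := by
    funext x y
    rw [ssTwoPoint_zero_eq_expect hN1 hL, ComplexSpin.expect_eq_div, ComplexSpin.twoPt]
    ring
  have hsym : (ComplexSpin.kernelSymbol (fun x y => ssTwoPoint N ν L 0 0 x y) χ).re =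
      ((2 * N : ℝ) ^ 2 / Z) * ComplexSpin.twoPtHat N 0 a χ := by
    rw [hker, kernelSymbol_const_mul, Complex.re_ofReal_mul, ComplexSpin.twoPtHat]
  have h1 := ComplexSpin.twoPtHat_mode_le hL i hcard hN1 0 hb χ
  have h2 := ComplexSpin.neg_twoPtHat_mode_le hL i hcard hN1 0 hb χ
  rw [← hZdef] at h1 h2
  have hNpos : (0 : ℝ) < N := by exact_mod_cast hN1
  have hc : 0 < (2 * N : ℝ) ^ 2 / Z := by positivity
  have hkey : (2 * N : ℝ) ^ 2 / Z * (1 / N * Z) = 4 * N := by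
    field_simp
    ring
  constructor
  · rw [hsym]
    calc 2 * ((ν : ℝ) - ComplexSpin.cosSum χ) * ((2 * N : ℝ) ^ 2 / Z * ComplexSpin.twoPtHat N 0 a χ)
        = (2 * N : ℝ) ^ 2 / Z * (2 * ((ν : ℝ) - ComplexSpin.cosSum χ) * ComplexSpin.twoPtHat N 0 a χ) := by ring
      _ ≤ (2 * N : ℝ) ^ 2 / Z * (1 / N * Z) := mul_le_mul_of_nonneg_left h1 hc.le
      _ = 4 * N := hkey
  · rw [hsym]
    calc 2 * ((ν : ℝ) + ComplexSpin.cosSum χ) * -((2 * N : ℝ) ^ 2 / Z * ComplexSpin.twoPtHat N 0 a χ)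
        = (2 * N : ℝ) ^ 2 / Z * (2 * ((ν : ℝ) + ComplexSpin.cosSum χ) * -ComplexSpin.twoPtHat N 0 a χ) := by ring
      _ ≤ (2 * N : ℝ) ^ 2 / Z * (1 / N * Z) := mul_le_mul_of_nonneg_left h2 hc.le
      _ = 4 * N := hkey

/-- **Row S4 at `β = 0` is a theorem**: (SD)_{0,(2N)²/K(N)} for `1 ≤ N ≤ 4` on every even torus (`ν ≥ 1`) — the Schwinger–Dyson lower bound (4.38) with Remark 4.6's `K(N)`
(`K(1) = 1`, `K(2) = 2`, `K(3) = 10/3`, `K(4) = 5 + 8/15`), times `(2N)²`. [cite: SalmhoferSeiler1991, Thm. 4.8 (4.38) with Remark 4.6] -/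
theorem schwingerDysonBound_zero (hN1 : 1 ≤ N) (hN4 : N ≤ 4) (hν : 1 ≤ ν) (hL : Even L) :
    (2 * N : ℝ) ^ 2 / ComplexSpin.sdK N (ComplexSpin.uNLogCoeff N) ≤
      ∑ μ : Fin ν, (ssTwoPoint N ν L 0 0 0 (Pi.single μ 1) + ssTwoPoint N ν L 0 0 0 (-Pi.single μ 1)) := by
  haveI : NeZero ν := ⟨by omega⟩
  set a := ComplexSpin.uNBondCoeff N with ha
  set w := ComplexSpin.uNLogCoeff N with hw
  have hlog : ComplexSpin.HasLog N a w := ComplexSpin.hasLog_uN hN1 hN4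
  have ha0 : a 0 = 1 := ComplexSpin.uNBondCoeff_zero N
  have hw1 : w 1 = 1 := ComplexSpin.uNLogCoeff_one N
  have hwk : ∀ k, 2 ≤ k → k ≤ N → 0 ≤ w k := fun k hk2 hkN => ComplexSpin.uNLogCoeff_nonneg hN4 k hk2 hkN
  have hw' : ∀ k, 1 ≤ k → k ≤ N → 0 ≤ w k := by
    intro k hk1 hkN
    rcases Nat.lt_or_ge k 2 with hk | hk
    · rw [show k = 1 by omega, hw1]; exact zero_le_one
    · exact hwk k hk hkN
  have hL2 : 2 ≤ L := by obtain ⟨k, hk⟩ := hL; have := NeZero.ne L; omega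
  have hapos := hlog.coeff_pos hN1 ha0 hw1 hwk
  set Z := ComplexSpin.partitionFunction (ν := ν) (L := L) N 0 a with hZdef
  have hZ : 0 < Z :=
    ComplexSpin.partitionFunction_pos hL.two_dvd hL2 hν le_rfl (hlog.coeff_nonneg ha0 hw') (hapos 0 (Nat.zero_le N))
      (hapos N le_rfl)
  have hK : 0 < ComplexSpin.sdK N w := lt_of_lt_of_le one_pos (ComplexSpin.one_le_sdK hN1 hw1 hwk)
  -- (4.38) at `m = 0`, `x = 0`
  have h38 := ComplexSpin.partitionFunction_le_sd (ν := ν) (L := L) hN1 hlog ha0 hw1 hwk hL2 (le_refl (0 : ℝ))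
    (0 : TorusSite ν L)
  rw [mul_zero, zero_mul, zero_add, ComplexSpin.sum_bracket_nbr_zero, ← hZdef] at h38
  -- in the conjecture's normalisation
  have hterm : ∀ z : TorusSite ν L, ssTwoPoint N ν L 0 0 0 z = (2 * N : ℝ) ^ 2 / Z * ComplexSpin.twoPt N 0 a 0 z := by
    intro z
    rw [ssTwoPoint_zero_eq_expect hN1 hL, ComplexSpin.expect_eq_div, ComplexSpin.twoPt]
    ring
  simp_rw [hterm, ← mul_add]
  rw [← Finset.mul_sum, div_le_iff₀ hK]
  have hNsq : 0 ≤ (2 * N : ℝ) ^ 2 := by positivity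
  calc (2 * N : ℝ) ^ 2 = (2 * N : ℝ) ^ 2 / Z * Z := by field_simp
    _ ≤ (2 * N : ℝ) ^ 2 / Z * (ComplexSpin.sdK N w *
          ∑ μ : Fin ν, (ComplexSpin.twoPt N 0 a (0 : TorusSite ν L) (Pi.single μ 1) +
            ComplexSpin.twoPt N 0 a (0 : TorusSite ν L) (-Pi.single μ 1))) :=
        mul_le_mul_of_nonneg_left h38 (by positivity)
    _ = ((2 * N : ℝ) ^ 2 / Z * ∑ μ : Fin ν, (ComplexSpin.twoPt N 0 a (0 : TorusSite ν L) (Pi.single μ 1) +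
            ComplexSpin.twoPt N 0 a (0 : TorusSite ν L) (-Pi.single μ 1))) * ComplexSpin.sdK N w := by ring

/-- **The reduction reproduces (4.42) at `β = 0`**: for `1 ≤ N ≤ 4` on every even torus (`ν ≥ 1`),
`ssChiralOrder N ν L 0 ≥ (1/4ν)((2N)²/K(N) - 8N·S_Λ(ν)) = (2N)²(1/4ν)(1/K(N) - 2S_Λ(ν)/N)`. [cite: SalmhoferSeiler1991, Thm. 4.8 ((4.41)–(4.42)) and Cor. 4.9] -/
theorem ssChiralOrder_zero_ge (hN1 : 1 ≤ N) (hN4 : N ≤ 4) (hν : 1 ≤ ν) (hL : Even L) :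
    1 / (4 * ν) * ((2 * N : ℝ) ^ 2 / ComplexSpin.sdK N (ComplexSpin.uNLogCoeff N) -
        2 * (4 * N) * ComplexSpin.latticeS ν L) ≤ ssChiralOrder N ν L 0 :=
  ssChiralOrder_ge_of_bounds N ν L hν hL (fun χ _ _ => infraredBound_zero hN1 hN4 hν hL χ)
    (schwingerDysonBound_zero hN1 hN4 hν hL)

/-! ### Row S3 at `β = 0` for EVERY `N ≥ 1` (Remark 4.5: `b_k ≥ 0` for all `N`) -/

/-- The `U(N)` bond coefficients `a_k = (N-k)!/(N!k!)·N^{2k}` are positive for `k ≤ N`, `N ≥ 1`. [cite: SalmhoferSeiler1991, (2.23)] -/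
theorem uNBondCoeff_pos (hN : 1 ≤ N) (k : ℕ) (hk : k ≤ N) : 0 < ComplexSpin.uNBondCoeff N k := by
  unfold ComplexSpin.uNBondCoeff
  rw [if_pos hk]
  have hNpos : (0 : ℝ) < N := by exact_mod_cast hN
  positivity

/-- **Row S3 at `β = 0` for every `N ≥ 1`**: (IR)_{0,4N} on every even torus (`ν ≥ 1`) — the infrared
bound Thm. 3.21 needs only `b_k ≥ 0`, which Remark 4.5 gives for the `U(N)` model for ALL `N` (tree:
`ComplexSpin.uN_fluctCoeff_nonneg`); the restriction `N ≤ 4` of `infraredBound_zero` (inherited from the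
`w_k ≥ 0` bookkeeping of row S4) is not needed for row S3. [cite: SalmhoferSeiler1991, Thm. 3.21 with Remark 4.5 and (3.112)–(3.113)] -/
theorem infraredBound_zero_of_one_le (hN1 : 1 ≤ N) (hν : 1 ≤ ν) (hL : Even L) (χ : AddChar (TorusSite ν L) ℂ) :
    2 * ((ν : ℝ) - ComplexSpin.cosSum χ) *
          (ComplexSpin.kernelSymbol (fun x y => ssTwoPoint N ν L 0 0 x y) χ).re ≤ 4 * N ∧
      2 * ((ν : ℝ) + ComplexSpin.cosSum χ) *
          (-(ComplexSpin.kernelSymbol (fun x y => ssTwoPoint N ν L 0 0 x y) χ).re) ≤ 4 * N := by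
  haveI : NeZero ν := ⟨by omega⟩
  set a := ComplexSpin.uNBondCoeff N with ha
  have hb : ∀ k ≤ N, 0 ≤ ComplexSpin.fluctCoeff N a k := fun k hk => ComplexSpin.uN_fluctCoeff_nonneg hN1 k hk
  have hL2 : 2 ≤ L := by obtain ⟨k, hk⟩ := hL; have := NeZero.ne L; omega
  have hZ : 0 < ComplexSpin.partitionFunction (ν := ν) (L := L) N 0 a :=
    ComplexSpin.partitionFunction_pos hL.two_dvd hL2 hν le_rfl (fun k hk => (uNBondCoeff_pos hN1 k hk).le)
      (uNBondCoeff_pos hN1 0 (Nat.zero_le N)) (uNBondCoeff_pos hN1 N le_rfl)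
  have hcard : 2 ≤ Fintype.card (TorusSite ν L) := by
    rw [Fintype.card_fun, ZMod.card, Fintype.card_fin]
    calc 2 ≤ L := hL2
      _ ≤ L ^ ν := Nat.le_self_pow (by omega) L
  set i : Fin ν := ⟨0, hν⟩
  set Z := ComplexSpin.partitionFunction (ν := ν) (L := L) N 0 a with hZdef
  have hker : (fun x y => ssTwoPoint N ν L 0 0 x y) =
      fun x y => ((2 * N : ℝ) ^ 2 / Z) * ComplexSpin.twoPt N 0 a x y := by
    funext x y
    rw [ssTwoPoint_zero_eq_expect hN1 hL, ComplexSpin.expect_eq_div, ComplexSpin.twoPt]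
    ring
  have hsym : (ComplexSpin.kernelSymbol (fun x y => ssTwoPoint N ν L 0 0 x y) χ).re =
      ((2 * N : ℝ) ^ 2 / Z) * ComplexSpin.twoPtHat N 0 a χ := by
    rw [hker, kernelSymbol_const_mul, Complex.re_ofReal_mul, ComplexSpin.twoPtHat]
  have h1 := ComplexSpin.twoPtHat_mode_le hL i hcard hN1 0 hb χ
  have h2 := ComplexSpin.neg_twoPtHat_mode_le hL i hcard hN1 0 hb χ
  rw [← hZdef] at h1 h2
  have hNpos : (0 : ℝ) < N := by exact_mod_cast hN1
  have hc : 0 < (2 * N : ℝ) ^ 2 / Z := by positivity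
  have hkey : (2 * N : ℝ) ^ 2 / Z * (1 / N * Z) = 4 * N := by
    field_simp
    ring
  constructor
  · rw [hsym]
    calc 2 * ((ν : ℝ) - ComplexSpin.cosSum χ) * ((2 * N : ℝ) ^ 2 / Z * ComplexSpin.twoPtHat N 0 a χ)
        = (2 * N : ℝ) ^ 2 / Z * (2 * ((ν : ℝ) - ComplexSpin.cosSum χ) * ComplexSpin.twoPtHat N 0 a χ) := by ring
      _ ≤ (2 * N : ℝ) ^ 2 / Z * (1 / N * Z) := mul_le_mul_of_nonneg_left h1 hc.le
      _ = 4 * N := hkey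
  · rw [hsym]
    calc 2 * ((ν : ℝ) + ComplexSpin.cosSum χ) * -((2 * N : ℝ) ^ 2 / Z * ComplexSpin.twoPtHat N 0 a χ)
        = (2 * N : ℝ) ^ 2 / Z * (2 * ((ν : ℝ) + ComplexSpin.cosSum χ) * -ComplexSpin.twoPtHat N 0 a χ) := by ring
      _ ≤ (2 * N : ℝ) ^ 2 / Z * (1 / N * Z) := mul_le_mul_of_nonneg_left h2 hc.le
      _ = 4 * N := hkey

end Zero

end Summit.Ventures.YMGap.Conjectures

end
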